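import Summits.QuantumFields.BalabanUV.Beta.PropagatorWoodburyFibreReduction
import Literature.MathematicalPhysics.QuantumFieldTheory.King1986.UniformDecay

/-!
# Beta / GAN24 / WoodburyFibreGaugeSection — the SCALAR OPERATOR OF THE LANDAU-TYPE BLOCK GAUGE reduced to King's
one-form objects: the block-constrained inverse of a SQUARED form `L²` is `Γ · P⊥_ℋ · Γ` (Woodbury–Schur, exact), and the
block bi-Laplacian `N⁴Δ² + a·Q*Q` is `N`-UNIFORMLY COERCIVE by King's Lemma 29 (`fineOp_coercive_unif`) BY NAME

Cell `pub-balaban`, β sub-cell, BINDER ROW **G-an2-4 ∕ (CONV-C)** («non-abelian one-step η-rate comparison of the constituent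
kernels `(G_k, H_k, C^{(k)})` at `U = 1` — NOT IN PRINT»), prover part **P3 = WOODBURY-FIBRE reduction** (lineage
`b2b-balaban-gan24-p3`, gen 5).  HONEST FRAMING (verbatim): discharging `BetaPertH` makes Bałaban's UV stability UNCONDITIONAL —
a real constructive-QFT result; it is NOT the continuum limit and NOT the Clay problem.  HONEST DEPENDENCY: continuum YM on T⁴ ⇐
BetaPertH ∧ nine spine estimates (0/9 proved); BetaPertH ⇐ (D1) ∧ (D4) ∧ CAP+tail; G-an2-4 gates asym, D1 and NE2/3/4.  THIS FILE
DISCHARGES NOTHING of (CONV-C) or `BetaPertH`: it is `[folklore]` finite-dimensional linear algebra over the vocabulary of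
`Beta/PropagatorWoodburyFibre` (`pivot`, `effForm`, `minimiser`, `flucCov`, `comultiplier`, `kkt`) plus ONE instance of a tree
theorem (King ∕ Dimock Lemma 29, `King1986.Torus.fineOp_coercive_unif`) consumed BY NAME; nothing printed and nothing
programme-internal is a hypothesis (ABSOLUTE RULE honoured).

## Why (the located obstruction of the P3 census, `HOME/b2b-balaban-gan24-p3/WOODBURY-FIBRE.md` §3 rows (a)∕(d)∕V7)

By `GAN24/WoodburyFibreTransport` (gen 4) the field blocks of the weak (Landau-type block) gauge are the field blocks of ANY other
complete slice CONJUGATED by the slice projector `P = 1 − D(RD)⁻¹R`; the census located the whole `N`-dependence of the weak-gauge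
section in the Green's function `(RD)⁻¹`, which for Bałaban's Landau-type block gauge [B5 (1.27)–(1.28) p.22 — locator, not a
hypothesis] is the BLOCK-SUM-CONSTRAINED INVERSE OF THE SQUARED LAPLACIAN — the β sub-cell's `Beta.BiLaplaceBlockKKT.Sb`
(an2, AN2.md §15.4 brick (G″): «decay at FIXED N; any N-uniform estimate NOT here»).  This file reduces that object EXACTLY to the
ONE-FORM objects of the same constraint — King's fluctuation covariance `Γ`, minimiser `ℋ` and true multiplier block `E` of the
regularised form `L + QᴴTQ` — and proves the first `N`-uniform input (coercivity) from King's kernel theorem by name: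

* §1 `coproj X = 1 − X(XᴴX)⁻¹Xᴴ` (orthogonal coprojector of a family of columns): `Xᴴ·coproj X = 0`, `coproj X · X = 0`,
  Hermitian, idempotent.
* §2 base identities of the regularised one-form system `H_T := L + QᴴTQ` against the BARE form `L`:
  `Γ·L = 1 − ℋQ`, `L·Γ = 1 − Qᴴℋ♭`, `L·ℋ = Qᴴ·E` (`E := Δ_eff(H_T) − T`, the `T`-independent true multiplier block of
  `PropagatorWoodburyFibreReduction.effForm_sub_reg_indep`), `ℋᴴQᴴ = 1`.
* §3 **THE BI-FORM BORDERED INVERSE** (`kkt_sq_mul_biBlocks`, `inv_kkt_sq`, `isUnit_kkt_sq`): for Hermitian `L`, `T` with `H_T`, its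
  pivot and the Gram matrix `ℋᴴℋ` units,
  `[[L·L, Qᴴ],[Q, 0]]⁻¹ = [[Γ·coproj ℋ·Γ, ℋ + Γℋ(ℋᴴℋ)⁻¹E],[ℋᴴ + E(ℋᴴℋ)⁻¹ℋᴴΓ, −E(ℋᴴℋ)⁻¹E]]`;
  in particular the bordered bi-form matrix is a unit with NO hypothesis on `L·L` itself.  READINGS (`flucCov_sq_reg`,
  `minimiser_sq_reg`, `effForm_sq_reg_sub`): for every admissible bi-form regulariser `T₂`,
  **`Γ(L·L + QᴴT₂Q, Q) = Γ · coproj ℋ · Γ`** (the constrained inverse of the squared form = the one-form fluctuation covariance,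
  sandwiched around the projector ORTHOGONAL TO THE ONE-FORM MINIMISER COLUMNS), `ℋ(L·L + QᴴT₂Q, Q) = ℋ + Γℋ(ℋᴴℋ)⁻¹E`,
  `Δ_eff(L·L + QᴴT₂Q, Q) − T₂ = E(ℋᴴℋ)⁻¹E` («(1.66) for `Δ²`»: the true multiplier block of the bi-form is the one-form's, squared
  through the inverse Gram matrix).  So the ONLY new object beyond King's `Γ, ℋ, E` is the `m × m` Gram ∕ capacitance matrix
  `ℋᴴℋ` of the one-form minimiser columns (block-indexed); `N`-uniform decay of the gauge section ⇐ `N`-uniform decay of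
  `Γ`, `ℋ` and of `(ℋᴴℋ)⁻¹` (finite Combes–Thomas on a block-indexed matrix coercive by `ℋᴴℋ ⪰ (QQᴴ)⁻¹`) — census row V9.
* §3b `gram_minimiser_eq`: `ℋᴴℋ = (QQᴴ)⁻¹ + ℋᴴ·coproj Qᴴ·ℋ` (split along `range Qᴴ ⊕ ker Q`), and for real data
  `gram_minimiser_form_ge`: `⟨x,(QQᴴ)⁻¹x⟩ ≤ ⟨x, ℋᴴℋ x⟩` — the capacitance matrix is coercive UNIFORMLY (King: `N^{−d}ℋᴴℋ ⪰ 1`).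
* §4 **COERCIVITY OF A SQUARED FORM PLUS A CONSTRAINT MASS** (`coercive_sq_add`, real symmetric `S`, `P ⪰ 0`):
  `S + P ⪰ γ ⇒ S·S + P ⪰ min(γ/2, γ²/4)` (Cauchy–Schwarz `⟨x,Sx⟩² ≤ ‖x‖²‖Sx‖²` and a two-case split); instance
  **`biFineOp_coercive_unif`**: King's fine-torus operator with the Laplacian SQUARED, `(N²(−Δ))² + a·Q*Q ⪰ min(γ_A/2, γ_A²/4)`
  for ALL `N ≥ 1`, all tori, `γ_A = King1986.Torus.gamA a d` — from `King1986.Torus.fineOp_coercive_unif` (Dimock's Lemma 29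
  [Dimock2013, App. D] in King's normalisation, IN THE TREE) BY NAME.  This is the `hpos` input of the cell's Combes–Thomas modules
  (`Beta.CombesThomasForm.combesThomas_lattice`, `QGQInverse.inverse_decay`) for the block bi-Laplacian, uniform in `N`.

NOT here (census v4 rows V8∕V9): the `N`-uniform DECAY of the block bi-Laplacian Green's function in block units (the tree's
Combes–Thomas smallness for `N⁴Δ²` with weight `κ/N` scales as `N²κ²`; the uniform rate needs a RELATIVE conjugation bound or §3
with `N`-uniform fine-level decay of King's `Γ`, `ℋ` — printed [Ba4]∕Dimock 2013, not in the tree at fine level); nothing is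
instantiated on `Beta.BiLaplaceBlockKKT.Sb` or on `OneStepResolventKernel.KInv` (dictionary = an2's programme).
-/

namespace Summit.QuantumFields.BalabanUV.Beta.GAN24.WoodburyFibreGaugeSection

open Matrix
open Summit.QuantumFields.BalabanUV.Beta.PropagatorWoodburyFibre

section Algebra

variable {𝕜 : Type*} [Field 𝕜] [StarRing 𝕜]
variable {m n : Type*} [Fintype m] [Fintype n] [DecidableEq m] [DecidableEq n]

/-! ## §1 The coprojector of a family of columns -/

/-- `coproj X := 1 − X (XᴴX)⁻¹ Xᴴ` — for a unit Gram matrix `XᴴX`, the projector onto the orthogonal complement of the columns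
of `X`. [folklore] -/
noncomputable def coproj (X : Matrix n m 𝕜) : Matrix n n 𝕜 := 1 - X * (Xᴴ * X)⁻¹ * Xᴴ

omit [Fintype m] [DecidableEq m] [DecidableEq n] in
/-- The Gram matrix is Hermitian. [folklore] -/
theorem gram_conjTranspose (X : Matrix n m 𝕜) : (Xᴴ * X)ᴴ = Xᴴ * X := by
  rw [conjTranspose_mul, conjTranspose_conjTranspose]

/-- `Xᴴ · coproj X = 0`. [folklore] -/
theorem conjTranspose_mul_coproj {X : Matrix n m 𝕜} (hG : IsUnit (Xᴴ * X)) : Xᴴ * coproj X = 0 := by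
  have hG' := (isUnit_iff_isUnit_det _).mp hG
  have h1 : Xᴴ * (X * (Xᴴ * X)⁻¹ * Xᴴ) = (Xᴴ * X) * (Xᴴ * X)⁻¹ * Xᴴ := by simp only [Matrix.mul_assoc]
  rw [coproj, Matrix.mul_sub, Matrix.mul_one, h1, mul_nonsing_inv _ hG', Matrix.one_mul, sub_self]

/-- `coproj X · X = 0`. [folklore] -/
theorem coproj_mul_self {X : Matrix n m 𝕜} (hG : IsUnit (Xᴴ * X)) : coproj X * X = 0 := by
  have hG' := (isUnit_iff_isUnit_det _).mp hG
  have h1 : X * (Xᴴ * X)⁻¹ * Xᴴ * X = X * ((Xᴴ * X)⁻¹ * (Xᴴ * X)) := by simp only [Matrix.mul_assoc]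
  rw [coproj, Matrix.sub_mul, Matrix.one_mul, h1, nonsing_inv_mul _ hG', Matrix.mul_one, sub_self]

/-- `coproj X` is Hermitian. [folklore] -/
theorem coproj_conjTranspose (X : Matrix n m 𝕜) : (coproj X)ᴴ = coproj X := by
  rw [coproj, conjTranspose_sub, conjTranspose_one, conjTranspose_mul, conjTranspose_mul, conjTranspose_conjTranspose,
    conjTranspose_nonsing_inv, gram_conjTranspose, Matrix.mul_assoc]

/-- `coproj X` is idempotent. [folklore] -/
theorem coproj_mul_coproj {X : Matrix n m 𝕜} (hG : IsUnit (Xᴴ * X)) : coproj X * coproj X = coproj X := by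
  calc coproj X * coproj X = (1 - X * (Xᴴ * X)⁻¹ * Xᴴ) * coproj X := rfl
    _ = coproj X - X * (Xᴴ * X)⁻¹ * (Xᴴ * coproj X) := by
        rw [Matrix.sub_mul, Matrix.one_mul]; simp only [Matrix.mul_assoc]
    _ = coproj X := by rw [conjTranspose_mul_coproj hG, Matrix.mul_zero, sub_zero]

/-! ## §2 The regularised one-form system against the bare form

Notation in the docstrings: `H_T := L + QᴴTQ`, `Γ := flucCov H_T Q`, `ℋ := minimiser H_T Q`, `ℋ♭ := comultiplier H_T Q`,
`Δ := effForm H_T Q`, `E := Δ − T`. -/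

/-- `Γ · L = 1 − ℋ · Q` (the regulariser is invisible from the left: `Γ Qᴴ = 0`). [folklore] -/
theorem flucCov_reg_mul_base {L : Matrix n n 𝕜} {Q : Matrix m n 𝕜} (T : Matrix m m 𝕜) (hHT : IsUnit (L + Qᴴ * T * Q))
    (hP : IsUnit (pivot (L + Qᴴ * T * Q) Q)) :
    flucCov (L + Qᴴ * T * Q) Q * L = 1 - minimiser (L + Qᴴ * T * Q) Q * Q := by
  set H := L + Qᴴ * T * Q with hH
  have hL : L = H - Qᴴ * T * Q := by rw [hH]; abel
  have h1 : flucCov H Q * (Qᴴ * T * Q) = flucCov H Q * Qᴴ * (T * Q) := by simp only [Matrix.mul_assoc]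
  rw [hL, Matrix.mul_sub, flucCov_mul_form hHT, h1, flucCov_mul_constraint hP, Matrix.zero_mul, sub_zero]

/-- `L · Γ = 1 − Qᴴ · ℋ♭` (the regulariser is invisible from the right: `Q Γ = 0`). [folklore] -/
theorem base_mul_flucCov_reg {L : Matrix n n 𝕜} {Q : Matrix m n 𝕜} (T : Matrix m m 𝕜) (hHT : IsUnit (L + Qᴴ * T * Q))
    (hP : IsUnit (pivot (L + Qᴴ * T * Q) Q)) :
    L * flucCov (L + Qᴴ * T * Q) Q = 1 - Qᴴ * comultiplier (L + Qᴴ * T * Q) Q := by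
  set H := L + Qᴴ * T * Q with hH
  have hL : L = H - Qᴴ * T * Q := by rw [hH]; abel
  have h1 : Qᴴ * T * Q * flucCov H Q = Qᴴ * T * (Q * flucCov H Q) := by simp only [Matrix.mul_assoc]
  rw [hL, Matrix.sub_mul, form_mul_flucCov hHT, h1, constraint_mul_flucCov hP, Matrix.mul_zero, sub_zero]

/-- `L · ℋ = Qᴴ · E`: the bare form maps the minimiser columns INTO the range of `Qᴴ`, with coefficient the true multiplier
block `E = Δ − T`. [folklore] -/
theorem base_mul_minimiser_reg {L : Matrix n n 𝕜} {Q : Matrix m n 𝕜} (T : Matrix m m 𝕜) (hHT : IsUnit (L + Qᴴ * T * Q))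
    (hP : IsUnit (pivot (L + Qᴴ * T * Q) Q)) :
    L * minimiser (L + Qᴴ * T * Q) Q = Qᴴ * (effForm (L + Qᴴ * T * Q) Q - T) := by
  set H := L + Qᴴ * T * Q with hH
  have hHT' := (isUnit_iff_isUnit_det _).mp hHT
  have hL : L = H - Qᴴ * T * Q := by rw [hH]; abel
  have h1 : H * minimiser H Q = (H * H⁻¹) * (Qᴴ * effForm H Q) := by simp only [minimiser, Matrix.mul_assoc]
  have h2 : Qᴴ * T * Q * minimiser H Q = Qᴴ * T * (Q * minimiser H Q) := by simp only [Matrix.mul_assoc]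
  rw [hL, Matrix.sub_mul, h1, mul_nonsing_inv _ hHT', Matrix.one_mul, h2, constraint_mul_minimiser hP, Matrix.mul_one,
    Matrix.mul_sub]

omit [Fintype n] [DecidableEq m] [DecidableEq n] in
/-- `H_T` is Hermitian when `L` and `T` are. [folklore] -/
theorem isHermitian_reg {L : Matrix n n 𝕜} {Q : Matrix m n 𝕜} {T : Matrix m m 𝕜} (hL : Lᴴ = L) (hT : Tᴴ = T) :
    (L + Qᴴ * T * Q).IsHermitian := by
  change (L + Qᴴ * T * Q)ᴴ = L + Qᴴ * T * Q
  rw [conjTranspose_add, conjTranspose_mul, conjTranspose_mul, conjTranspose_conjTranspose, hL, hT, Matrix.mul_assoc]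

/-- `ℋᴴ · Qᴴ = 1` for Hermitian `H_T`. [folklore] -/
theorem conjTranspose_minimiser_mul_constraint {H : Matrix n n 𝕜} {Q : Matrix m n 𝕜} (hH : H.IsHermitian)
    (hP : IsUnit (pivot H Q)) : (minimiser H Q)ᴴ * Qᴴ = 1 := by
  rw [← comultiplier_eq_conjTranspose hH, comultiplier_mul_constraint hP]

/-! ## §3 The bordered inverse of the SQUARED form -/

/-- The candidate inverse of `[[L·L, Qᴴ],[Q, 0]]` in terms of the one-form objects of `H_T = L + QᴴTQ`:
`[[Γ·coproj ℋ·Γ, ℋ + Γℋ(ℋᴴℋ)⁻¹E],[ℋᴴ + E(ℋᴴℋ)⁻¹ℋᴴΓ, −E(ℋᴴℋ)⁻¹E]]`. [folklore] -/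
noncomputable def biBlocks (L : Matrix n n 𝕜) (Q : Matrix m n 𝕜) (T : Matrix m m 𝕜) : Matrix (n ⊕ m) (n ⊕ m) 𝕜 :=
  fromBlocks
    (flucCov (L + Qᴴ * T * Q) Q * coproj (minimiser (L + Qᴴ * T * Q) Q) * flucCov (L + Qᴴ * T * Q) Q)
    (minimiser (L + Qᴴ * T * Q) Q
      + flucCov (L + Qᴴ * T * Q) Q * minimiser (L + Qᴴ * T * Q) Q
          * ((minimiser (L + Qᴴ * T * Q) Q)ᴴ * minimiser (L + Qᴴ * T * Q) Q)⁻¹ * (effForm (L + Qᴴ * T * Q) Q - T))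
    ((minimiser (L + Qᴴ * T * Q) Q)ᴴ
      + (effForm (L + Qᴴ * T * Q) Q - T) * ((minimiser (L + Qᴴ * T * Q) Q)ᴴ * minimiser (L + Qᴴ * T * Q) Q)⁻¹
          * (minimiser (L + Qᴴ * T * Q) Q)ᴴ * flucCov (L + Qᴴ * T * Q) Q)
    (-((effForm (L + Qᴴ * T * Q) Q - T) * ((minimiser (L + Qᴴ * T * Q) Q)ᴴ * minimiser (L + Qᴴ * T * Q) Q)⁻¹
          * (effForm (L + Qᴴ * T * Q) Q - T)))

/-- **KKT FOR THE SQUARED FORM**: `[[L·L, Qᴴ],[Q, 0]] · biBlocks L Q T = 1` — hypotheses on the REGULARISED ONE-FORM system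
only (`L`, `T` Hermitian; `H_T`, its pivot, and the Gram matrix `ℋᴴℋ` units). [folklore] -/
theorem kkt_sq_mul_biBlocks {L : Matrix n n 𝕜} {Q : Matrix m n 𝕜} {T : Matrix m m 𝕜} (hL : Lᴴ = L) (hT : Tᴴ = T)
    (hHT : IsUnit (L + Qᴴ * T * Q)) (hP : IsUnit (pivot (L + Qᴴ * T * Q) Q))
    (hG : IsUnit ((minimiser (L + Qᴴ * T * Q) Q)ᴴ * minimiser (L + Qᴴ * T * Q) Q)) :
    kkt (L * L) Q * biBlocks L Q T = 1 := by
  set H := L + Qᴴ * T * Q with hHdef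
  set Γ := flucCov H Q with hΓ
  set ℋ := minimiser H Q with hℋ
  set E := effForm H Q - T with hE
  set G := (ℋᴴ * ℋ)⁻¹ with hGdef
  have hG' := (isUnit_iff_isUnit_det _).mp hG
  have hHh : H.IsHermitian := isHermitian_reg hL hT
  -- the base identities
  have hΓL : Γ * L = 1 - ℋ * Q := flucCov_reg_mul_base T hHT hP
  have hLΓ : L * Γ = 1 - Qᴴ * ℋᴴ := by
    rw [hΓ, base_mul_flucCov_reg T hHT hP, comultiplier_eq_conjTranspose hHh]
  have hLℋ : L * ℋ = Qᴴ * E := base_mul_minimiser_reg T hHT hP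
  have hQΓ : Q * Γ = 0 := constraint_mul_flucCov hP
  have hQℋ : Q * ℋ = 1 := constraint_mul_minimiser hP
  have hℋP : ℋᴴ * coproj ℋ = 0 := conjTranspose_mul_coproj hG
  have hGram : ℋᴴ * ℋ * G = 1 := mul_nonsing_inv _ hG'
  -- the four blocks
  have h11 : L * L * (Γ * coproj ℋ * Γ) = 1 - Qᴴ * ℋᴴ - Qᴴ * E * G * ℋᴴ * Γ := by
    calc L * L * (Γ * coproj ℋ * Γ)
        = L * ((L * Γ) * coproj ℋ * Γ) := by simp only [Matrix.mul_assoc]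
      _ = L * (coproj ℋ * Γ) - L * Qᴴ * (ℋᴴ * coproj ℋ) * Γ := by
          rw [hLΓ, Matrix.sub_mul, Matrix.sub_mul, Matrix.one_mul, Matrix.mul_sub]
          simp only [Matrix.mul_assoc]
      _ = L * Γ - (L * ℋ) * G * ℋᴴ * Γ := by
          rw [hℋP, Matrix.mul_zero, Matrix.zero_mul, sub_zero, coproj, ← hGdef, Matrix.sub_mul, Matrix.one_mul,
            Matrix.mul_sub]
          simp only [Matrix.mul_assoc]
      _ = 1 - Qᴴ * ℋᴴ - Qᴴ * E * G * ℋᴴ * Γ := by rw [hLΓ, hLℋ]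
  have h12 : L * L * (ℋ + Γ * ℋ * G * E) = Qᴴ * E * G * E := by
    have e1 : L * L * (ℋ + Γ * ℋ * G * E) = L * (L * ℋ) + L * (L * Γ) * (ℋ * (G * E)) := by
      rw [Matrix.mul_add]; simp only [Matrix.mul_assoc]
    have e2 : L * (ℋ * (G * E)) = Qᴴ * (E * (G * E)) := by rw [← Matrix.mul_assoc, hLℋ, Matrix.mul_assoc]
    have e3 : L * (Qᴴ * ℋᴴ) * (ℋ * (G * E)) = L * Qᴴ * ((ℋᴴ * ℋ * G) * E) := by simp only [Matrix.mul_assoc]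
    have e4 : L * (Qᴴ * E) = L * Qᴴ * E := (Matrix.mul_assoc _ _ _).symm
    have e5 : Qᴴ * E * G * E = Qᴴ * (E * (G * E)) := by simp only [Matrix.mul_assoc]
    rw [e1, hLℋ, hLΓ, Matrix.mul_sub L (1 : Matrix n n 𝕜) (Qᴴ * ℋᴴ), Matrix.mul_one,
      Matrix.sub_mul L (L * (Qᴴ * ℋᴴ)) (ℋ * (G * E)), e2, e3, hGram, Matrix.one_mul, e4, e5]
    abel
  have h21 : Q * (Γ * coproj ℋ * Γ) = 0 := by
    rw [Matrix.mul_assoc, ← Matrix.mul_assoc Q, hQΓ, Matrix.zero_mul]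
  have h22 : Q * (ℋ + Γ * ℋ * G * E) = 1 := by
    have e : Q * (Γ * ℋ * G * E) = (Q * Γ) * ℋ * G * E := by simp only [Matrix.mul_assoc]
    rw [Matrix.mul_add, hQℋ, e, hQΓ, Matrix.zero_mul, Matrix.zero_mul, Matrix.zero_mul, add_zero]
  rw [kkt, biBlocks, ← hHdef, ← hΓ, ← hℋ, ← hE, ← hGdef, fromBlocks_multiply, ← fromBlocks_one, fromBlocks_inj]
  refine ⟨?_, ?_, ?_, ?_⟩
  · rw [h11, Matrix.mul_add]
    have e : Qᴴ * (E * G * ℋᴴ * Γ) = Qᴴ * E * G * ℋᴴ * Γ := by simp only [Matrix.mul_assoc]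
    rw [e]
    abel
  · rw [h12, Matrix.mul_neg]
    have e : Qᴴ * (E * G * E) = Qᴴ * E * G * E := by simp only [Matrix.mul_assoc]
    rw [e, add_neg_cancel]
  · rw [h21, Matrix.zero_mul, add_zero]
  · rw [h22, Matrix.zero_mul, add_zero]

/-- **THE BORDERED INVERSE OF THE SQUARED FORM** is `biBlocks L Q T`. [folklore] -/
theorem inv_kkt_sq {L : Matrix n n 𝕜} {Q : Matrix m n 𝕜} {T : Matrix m m 𝕜} (hL : Lᴴ = L) (hT : Tᴴ = T)
    (hHT : IsUnit (L + Qᴴ * T * Q)) (hP : IsUnit (pivot (L + Qᴴ * T * Q) Q))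
    (hG : IsUnit ((minimiser (L + Qᴴ * T * Q) Q)ᴴ * minimiser (L + Qᴴ * T * Q) Q)) :
    (kkt (L * L) Q)⁻¹ = biBlocks L Q T :=
  inv_eq_right_inv (kkt_sq_mul_biBlocks hL hT hHT hP hG)

/-- The bordered matrix of the squared form is a unit — with NO hypothesis on `L·L` itself. [folklore] -/
theorem isUnit_kkt_sq {L : Matrix n n 𝕜} {Q : Matrix m n 𝕜} {T : Matrix m m 𝕜} (hL : Lᴴ = L) (hT : Tᴴ = T)
    (hHT : IsUnit (L + Qᴴ * T * Q)) (hP : IsUnit (pivot (L + Qᴴ * T * Q) Q))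
    (hG : IsUnit ((minimiser (L + Qᴴ * T * Q) Q)ᴴ * minimiser (L + Qᴴ * T * Q) Q)) : IsUnit (kkt (L * L) Q) :=
  (Matrix.isUnit_iff_isUnit_det _).mpr (Matrix.isUnit_det_of_right_inverse (kkt_sq_mul_biBlocks hL hT hHT hP hG))

/-- `biBlocks L Q T` does not depend on the one-form regulariser `T`. [folklore] -/
theorem biBlocks_reg_indep {L : Matrix n n 𝕜} {Q : Matrix m n 𝕜} {T T' : Matrix m m 𝕜} (hL : Lᴴ = L) (hT : Tᴴ = T)
    (hT' : T'ᴴ = T') (hHT : IsUnit (L + Qᴴ * T * Q)) (hP : IsUnit (pivot (L + Qᴴ * T * Q) Q))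
    (hG : IsUnit ((minimiser (L + Qᴴ * T * Q) Q)ᴴ * minimiser (L + Qᴴ * T * Q) Q)) (hHT' : IsUnit (L + Qᴴ * T' * Q))
    (hP' : IsUnit (pivot (L + Qᴴ * T' * Q) Q))
    (hG' : IsUnit ((minimiser (L + Qᴴ * T' * Q) Q)ᴴ * minimiser (L + Qᴴ * T' * Q) Q)) :
    biBlocks L Q T = biBlocks L Q T' := by
  rw [← inv_kkt_sq hL hT hHT hP hG, inv_kkt_sq hL hT' hHT' hP' hG']

/-- **READING 1 — the block-constrained inverse of the squared form**: for every admissible bi-form regulariser `T₂`,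
`Γ(L·L + QᴴT₂Q, Q) = Γ · coproj ℋ · Γ` — the one-form fluctuation covariance sandwiched around the projector orthogonal to
the one-form minimiser columns. [folklore] -/
theorem flucCov_sq_reg {L : Matrix n n 𝕜} {Q : Matrix m n 𝕜} {T : Matrix m m 𝕜} (hL : Lᴴ = L) (hT : Tᴴ = T)
    (hHT : IsUnit (L + Qᴴ * T * Q)) (hP : IsUnit (pivot (L + Qᴴ * T * Q) Q))
    (hG : IsUnit ((minimiser (L + Qᴴ * T * Q) Q)ᴴ * minimiser (L + Qᴴ * T * Q) Q))
    (T₂ : Matrix m m 𝕜) (hHT₂ : IsUnit (L * L + Qᴴ * T₂ * Q)) (hP₂ : IsUnit (pivot (L * L + Qᴴ * T₂ * Q) Q)) :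
    flucCov (L * L + Qᴴ * T₂ * Q) Q
      = flucCov (L + Qᴴ * T * Q) Q * coproj (minimiser (L + Qᴴ * T * Q) Q) * flucCov (L + Qᴴ * T * Q) Q := by
  have h := inv_kkt_of_reg T₂ hHT₂ hP₂
  rw [inv_kkt_sq hL hT hHT hP hG, biBlocks] at h
  exact (fromBlocks_inj.mp h).1.symm

/-- **READING 2 — the minimiser of the squared form**: `ℋ(L·L + QᴴT₂Q, Q) = ℋ + Γℋ(ℋᴴℋ)⁻¹E`. [folklore] -/
theorem minimiser_sq_reg {L : Matrix n n 𝕜} {Q : Matrix m n 𝕜} {T : Matrix m m 𝕜} (hL : Lᴴ = L) (hT : Tᴴ = T)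
    (hHT : IsUnit (L + Qᴴ * T * Q)) (hP : IsUnit (pivot (L + Qᴴ * T * Q) Q))
    (hG : IsUnit ((minimiser (L + Qᴴ * T * Q) Q)ᴴ * minimiser (L + Qᴴ * T * Q) Q))
    (T₂ : Matrix m m 𝕜) (hHT₂ : IsUnit (L * L + Qᴴ * T₂ * Q)) (hP₂ : IsUnit (pivot (L * L + Qᴴ * T₂ * Q) Q)) :
    minimiser (L * L + Qᴴ * T₂ * Q) Q
      = minimiser (L + Qᴴ * T * Q) Q
        + flucCov (L + Qᴴ * T * Q) Q * minimiser (L + Qᴴ * T * Q) Q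
            * ((minimiser (L + Qᴴ * T * Q) Q)ᴴ * minimiser (L + Qᴴ * T * Q) Q)⁻¹ * (effForm (L + Qᴴ * T * Q) Q - T) := by
  have h := inv_kkt_of_reg T₂ hHT₂ hP₂
  rw [inv_kkt_sq hL hT hHT hP hG, biBlocks] at h
  exact (fromBlocks_inj.mp h).2.1.symm

/-- **READING 3 — «(1.66) for the squared form»**: the true multiplier block of the bi-form is the one-form's squared through
the inverse Gram matrix, `Δ_eff(L·L + QᴴT₂Q, Q) − T₂ = E (ℋᴴℋ)⁻¹ E`. [folklore] -/
theorem effForm_sq_reg_sub {L : Matrix n n 𝕜} {Q : Matrix m n 𝕜} {T : Matrix m m 𝕜} (hL : Lᴴ = L) (hT : Tᴴ = T)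
    (hHT : IsUnit (L + Qᴴ * T * Q)) (hP : IsUnit (pivot (L + Qᴴ * T * Q) Q))
    (hG : IsUnit ((minimiser (L + Qᴴ * T * Q) Q)ᴴ * minimiser (L + Qᴴ * T * Q) Q))
    (T₂ : Matrix m m 𝕜) (hHT₂ : IsUnit (L * L + Qᴴ * T₂ * Q)) (hP₂ : IsUnit (pivot (L * L + Qᴴ * T₂ * Q) Q)) :
    effForm (L * L + Qᴴ * T₂ * Q) Q - T₂
      = (effForm (L + Qᴴ * T * Q) Q - T) * ((minimiser (L + Qᴴ * T * Q) Q)ᴴ * minimiser (L + Qᴴ * T * Q) Q)⁻¹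
          * (effForm (L + Qᴴ * T * Q) Q - T) := by
  have h := inv_kkt_of_reg T₂ hHT₂ hP₂
  rw [inv_kkt_sq hL hT hHT hP hG, biBlocks] at h
  have h4 := (fromBlocks_inj.mp h).2.2.2
  rw [neg_eq_iff_eq_neg, neg_sub] at h4
  exact h4.symm

/-! ## §3b The only new object: the Gram ∕ capacitance matrix `ℋᴴℋ` of the one-form minimiser columns -/
/-- **The Gram matrix splits along `range Qᴴ ⊕ ker Q`**: `ℋᴴℋ = (QQᴴ)⁻¹ + ℋᴴ · coproj Qᴴ · ℋ` (`Qℋ = 1`, `ℋᴴQᴴ = 1`;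
`coproj Qᴴ = 1 − Qᴴ(QQᴴ)⁻¹Q` is the projector onto `ker Q` when `QQᴴ` is a unit).  In King's normalisation (`Q` = block
means, `QQᴴ = N^{−d}·1`) this reads `N^{−d}·ℋᴴℋ = 1 + (fluctuation Gram) ⪰ 1`. [folklore] -/
theorem gram_minimiser_eq {H : Matrix n n 𝕜} {Q : Matrix m n 𝕜} (hH : H.IsHermitian) (hP : IsUnit (pivot H Q)) :
    (minimiser H Q)ᴴ * minimiser H Q = (Q * Qᴴ)⁻¹ + (minimiser H Q)ᴴ * coproj Qᴴ * minimiser H Q := by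
  have hQℋ := constraint_mul_minimiser hP
  have hℋQ := conjTranspose_minimiser_mul_constraint hH hP
  have e : (minimiser H Q)ᴴ * (Qᴴ * (Q * Qᴴ)⁻¹ * Q) * minimiser H Q
      = ((minimiser H Q)ᴴ * Qᴴ) * (Q * Qᴴ)⁻¹ * (Q * minimiser H Q) := by simp only [Matrix.mul_assoc]
  rw [coproj, conjTranspose_conjTranspose, Matrix.mul_sub, Matrix.mul_one, Matrix.sub_mul, e, hℋQ, hQℋ, Matrix.one_mul,
    Matrix.mul_one, add_sub_cancel]

end Algebra

/-! ## §4 Coercivity of a squared form plus a constraint mass; the block bi-Laplacian by King's Lemma 29 -/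

section Coercive

open Literature.MathematicalPhysics.QuantumFieldTheory.Balaban1983to89 (QGQInverse.Coercive)

variable {ι : Type*} [Fintype ι]

/-- **`S + P ⪰ γ ⇒ S·S + P ⪰ min(γ/2, γ²/4)`** for real symmetric `S` and form-nonnegative `P` (`γ ≥ 0`): with `u = ‖x‖²`,
`s = ⟨x,Sx⟩`, `q = ⟨x,Px⟩ ≥ 0`, `r = ‖Sx‖² ≥ s²/u` (Cauchy–Schwarz), either `s ≤ γu/2` and then `q ≥ γu/2`, or `s > γu/2` and
then `r ≥ γ²u/4`. [folklore] -/
theorem coercive_sq_add {S P : Matrix ι ι ℝ} (hS : Sᵀ = S) {γ : ℝ} (hγ : 0 ≤ γ) (hSP : QGQInverse.Coercive (S + P) γ)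
    (hP : ∀ x : ι → ℝ, 0 ≤ x ⬝ᵥ (P *ᵥ x)) : QGQInverse.Coercive (S * S + P) (min (γ / 2) (γ ^ 2 / 4)) := by
  intro x
  have hsq : x ⬝ᵥ ((S * S + P) *ᵥ x) = (S *ᵥ x) ⬝ᵥ (S *ᵥ x) + x ⬝ᵥ (P *ᵥ x) := by
    rw [Matrix.add_mulVec, dotProduct_add, ← Matrix.mulVec_mulVec, Matrix.dotProduct_mulVec, ← Matrix.mulVec_transpose, hS]
  rw [hsq]
  set u := x ⬝ᵥ x with hu
  set s := x ⬝ᵥ (S *ᵥ x) with hs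
  set r := (S *ᵥ x) ⬝ᵥ (S *ᵥ x) with hr
  set q := x ⬝ᵥ (P *ᵥ x) with hq
  have hu0 : 0 ≤ u := Finset.sum_nonneg fun i _ => mul_self_nonneg (x i)
  have hr0 : 0 ≤ r := Finset.sum_nonneg fun i _ => mul_self_nonneg ((S *ᵥ x) i)
  have hq0 : 0 ≤ q := hP x
  have hsum : γ * u ≤ s + q := by
    have h := hSP x
    rwa [Matrix.add_mulVec, dotProduct_add] at h
  have hCS : s ^ 2 ≤ u * r := by
    have h := Finset.sum_mul_sq_le_sq_mul_sq Finset.univ x (S *ᵥ x)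
    simp only [sq] at h ⊢
    exact h
  have hmin1 : min (γ / 2) (γ ^ 2 / 4) * u ≤ γ / 2 * u := mul_le_mul_of_nonneg_right (min_le_left _ _) hu0
  have hmin2 : min (γ / 2) (γ ^ 2 / 4) * u ≤ γ ^ 2 / 4 * u := mul_le_mul_of_nonneg_right (min_le_right _ _) hu0
  by_cases hcase : s ≤ γ * u / 2
  · nlinarith [hcase, hsum, hr0, hmin1]
  · push Not at hcase
    rcases hu0.eq_or_lt with hu00 | hupos
    · rw [← hu00, mul_zero] at hmin1 ⊢
      · linarith
    · have hs0 : 0 ≤ γ * u / 2 := by positivity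
      have h1 : (γ * u / 2) ^ 2 ≤ s ^ 2 := pow_le_pow_left₀ hs0 hcase.le 2
      have h2 : u * (γ ^ 2 / 4 * u) ≤ u * r := by nlinarith [h1, hCS]
      have h3 : γ ^ 2 / 4 * u ≤ r := le_of_mul_le_mul_left h2 hupos
      linarith [h3, hq0, hmin2]

/-- **The capacitance matrix is coercive, uniformly**: for REAL data, `⟨x, (QQᴴ)⁻¹x⟩ ≤ ⟨x, ℋᴴℋ x⟩` — the fluctuation
Gram `ℋᴴ·coproj Qᴴ·ℋ = (coproj Qᴴ·ℋ)ᴴ(coproj Qᴴ·ℋ)` is a nonnegative form (so in King's normalisation `N^{−d}ℋᴴℋ ⪰ 1` for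
every `N`: the `hpos` of the finite Combes–Thomas `QGQInverse.inverse_decay` for `(ℋᴴℋ)⁻¹`, `N`-free). [folklore] -/
theorem gram_minimiser_form_ge {μ : Type*} [Fintype μ] [DecidableEq μ] [DecidableEq ι] {H : Matrix ι ι ℝ}
    {Q : Matrix μ ι ℝ} (hH : H.IsHermitian) (hP : IsUnit (pivot H Q)) (hQ : IsUnit (Q * Qᴴ)) (x : μ → ℝ) :
    x ⬝ᵥ ((Q * Qᴴ)⁻¹ *ᵥ x) ≤ x ⬝ᵥ (((minimiser H Q)ᴴ * minimiser H Q) *ᵥ x) := by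
  have hQ' : IsUnit ((Qᴴ)ᴴ * Qᴴ) := by rwa [conjTranspose_conjTranspose]
  have hPP : coproj Qᴴ * coproj Qᴴ = coproj Qᴴ := coproj_mul_coproj hQ'
  have hPh : (coproj Qᴴ)ᴴ = coproj Qᴴ := coproj_conjTranspose _
  have hsq : (minimiser H Q)ᴴ * coproj Qᴴ * minimiser H Q
      = (coproj Qᴴ * minimiser H Q)ᴴ * (coproj Qᴴ * minimiser H Q) := by
    rw [conjTranspose_mul, hPh, Matrix.mul_assoc, Matrix.mul_assoc, ← Matrix.mul_assoc (coproj Qᴴ) (coproj Qᴴ), hPP,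
      ← Matrix.mul_assoc]
  have hv : x ᵥ* (coproj Qᴴ * minimiser H Q)ᴴ = (coproj Qᴴ * minimiser H Q) *ᵥ x := by
    rw [Matrix.vecMul_conjTranspose, star_trivial, star_trivial]
  rw [gram_minimiser_eq hH hP, Matrix.add_mulVec, dotProduct_add, le_add_iff_nonneg_right, hsq, ← Matrix.mulVec_mulVec,
    Matrix.dotProduct_mulVec, hv]
  exact Finset.sum_nonneg fun i _ => mul_self_nonneg _

open Literature.MathematicalPhysics.QuantumFieldTheory.Balaban1983to89.B5Prop11Plancherel (Tor fine)
open Literature.MathematicalPhysics.QuantumFieldTheory.King1986.Torus (lapF blockProj fineOp gamA lapF_comm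
  blockProj_form_nonneg fineOp_coercive_unif)

variable {d : ℕ} (N : ℕ) [NeZero N] (M : Fin d → ℕ) [hM : ∀ μ, NeZero (M μ)]

/-- **THE BLOCK BI-LAPLACIAN IS `N`-UNIFORMLY COERCIVE**: on King's fine torus `Π ℤ/(N M_μ)`, the operator
`(N²(−Δ))·(N²(−Δ)) + a·Q*Q` (the Laplacian SQUARED in block units plus the block-mean mass) satisfies
`⟨ψ, ·ψ⟩ ≥ min(γ_A/2, γ_A²/4)‖ψ‖²` for ALL `N ≥ 1`, all tori, with King's `γ_A = gamA a d` — from `King1986.Torus.fineOp_coercive_unif`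
(Dimock's Lemma 29 in King's normalisation, in the tree) BY NAME and `coercive_sq_add`. [folklore] -/
theorem biFineOp_coercive_unif (hN1 : 1 ≤ N) {a : ℝ} (ha : 0 ≤ a) :
    QGQInverse.Coercive
      (lapF (fine N M) ((N : ℝ) ^ 2) 0 * lapF (fine N M) ((N : ℝ) ^ 2) 0 + a • blockProj N M)
      (min (gamA a d / 2) (gamA a d ^ 2 / 4)) := by
  have hS : (lapF (fine N M) ((N : ℝ) ^ 2) 0)ᵀ = lapF (fine N M) ((N : ℝ) ^ 2) 0 :=
    Matrix.ext fun z z' => by rw [Matrix.transpose_apply]; exact lapF_comm (fine N M) _ _ z z'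
  have hSP : QGQInverse.Coercive (lapF (fine N M) ((N : ℝ) ^ 2) 0 + a • blockProj N M) (gamA a d) :=
    fineOp_coercive_unif N M hN1 ha le_rfl
  have hγ : 0 ≤ gamA a d := by
    unfold gamA
    refine le_min ?_ ?_ <;> positivity
  refine coercive_sq_add hS hγ hSP fun x => ?_
  rw [Matrix.smul_mulVec, dotProduct_smul, smul_eq_mul]
  exact mul_nonneg ha (blockProj_form_nonneg N M x)

end Coercive

end Summit.QuantumFields.BalabanUV.Beta.GAN24.WoodburyFibreGaugeSection
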